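import Literature.Topology.FourManifolds.TrisectionsHandleBoxes
import Literature.Topology.FourManifolds.TrisectionsChartZoneCore
import HarnessLib

/-!
# The weight `W` and the radial correction `R` of the second sector's Morse function

Topic `Literature/Topology/FourManifolds`; step E3d of a Morse-theoretic construction of
Gay–Kirby's trisection for the fact seat
`provefact-Literature.Topology.FourManifolds.exists_isBalancedGKTrisection` (Gay–Kirby 2016,
Thm. 4 via §4, Lemma 14).  Everything in this file is **proved**; the definitions are explicit.

The Morse function of the second sector is `Ψ₂ = U(s) · V(T - s) · W · R` (`s = f - a`, `T` the
top height of `TrisectionsTopHeight.lean`).  Here, over a system of `2`-handle boxes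
`H : HandleBoxes f ξ a η ι` and a Heegaard function `φ` on `Y = f⁻¹(a)`:

* `HandleBoxes.tubeHat` — the **smoothed tube function** of the `j`-th box,
  `𝒯̂_j = ĝ(x⃗) + (κ/η)|x⃗|²|y⃗|²` with `ĝ = ChartZone.gmod ε ρ` (`TrisectionsChartZoneCore.lean`),
  smooth on the chart domain, equal to the tube function `𝒯` of `TrisectionsTubeModel.lean`
  (the tree's Morse model of Gay–Kirby's tubular neighbourhood of the link) wherever
  `ρ(A) = 1/A`;
* `HandleBoxes.weight` — `W = w(c₀ 𝒯̂_j)` on the chart zones `{A_j < a_R}`, `w(φ̄)` elsewhere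
  (`φ̄ = flowLift φ`); the two recipes agree on the shell `{a_R/2 < A_j < 2a_R}` of the band
  (`weight_formula_of_mem_shell`: there every point hits the level, `φ̄ = φ ∘ π = c₀ 𝒯(π ·)`
  by the explicit form of `φ` near the tubes, `= c₀ 𝒯` by conservation of `𝒯`,
  `TubeFlowGeometry`, `= c₀ 𝒯̂`); hence **`W` is smooth on the band**
  (`HandleBoxes.contMDiffAt_weight`);
* `HandleBoxes.radial` — `R = R₀(A_j)` on `source_j`, `1` elsewhere, smooth on the band when
  `R₀ = 1` on `[a_R', ∞)`, `a_R' ≤ ε²` (`HandleBoxes.contMDiffAt_radial`).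

## References

* D. Gay, R. Kirby, *Trisecting 4-manifolds*, Geom. Topol. 20 (2016), §4, Lemma 14 and proof of
  Thm. 4. [GayKirby2016]
* J. Milnor, *Lectures on the h-cobordism theorem* (1965), Def. 3.1, Thm. 3.12, Thm. 4.1. [MilnorHCobordism1965]
-/

open scoped Manifold ContDiff Topology
open Set Function Filter Metric

noncomputable section

universe u

namespace Literature.Topology.FourManifolds

open Flow

/-- Local notation: `𝔼 n` is the model Euclidean space `EuclideanSpace ℝ (Fin n)`. -/
local notation "𝔼 " n:arg => EuclideanSpace ℝ (Fin n)

/-! ### The smoothed tube function on the model -/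

namespace TubeModel

/-- **The smoothed tube function** `𝒯̂(u) = ĝ(x⃗) + (κ/η)|x⃗|²|y⃗|²`, `ĝ(x⃗) = 1 - ε x₀² ρ(|x⃗|²)`
(the tube function `𝒯` of `TrisectionsTubeModel.lean` has `ρ(A) = 1/A`, singular on the co-core
plane `x⃗ = 0`; `ρ` is a smooth capping of `1/A`). [cite: GayKirby2016, §4, Lemma 14] -/
def tubeHat (ε κ η : ℝ) (ρ : ℝ → ℝ) (u : 𝔼 4) : ℝ :=
  ChartZone.gmod ε ρ (RadialThickening.proj u) + κ / η * nsq (RadialThickening.proj u) * RadialThickening.bsq u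

/-- Unfolding. [folklore] -/
theorem tubeHat_apply (ε κ η : ℝ) (ρ : ℝ → ℝ) (u : 𝔼 4) :
    tubeHat ε κ η ρ u = ChartZone.gmod ε ρ (RadialThickening.proj u) +
      κ / η * nsq (RadialThickening.proj u) * RadialThickening.bsq u := rfl

/-- **`𝒯̂ = 𝒯` wherever `ρ(|x⃗|²) = 1/|x⃗|²`.** [cite: GayKirby2016, §4, Lemma 14] -/
theorem tubeHat_eq_tube {ε κ η : ℝ} {ρ : ℝ → ℝ} {u : 𝔼 4}
    (hρ : ρ (nsq (RadialThickening.proj u)) = (nsq (RadialThickening.proj u))⁻¹) :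
    tubeHat ε κ η ρ u = tube ε κ η u := by
  rw [tubeHat_apply, tube_apply, ChartZone.gmod_apply, gcore_apply, hρ, RadialThickening.proj_apply_zero]
  ring

/-- The smoothed tube function is smooth for smooth `ρ`. [folklore] -/
theorem contDiff_tubeHat (ε κ η : ℝ) {ρ : ℝ → ℝ} (hρ : ContDiff ℝ ∞ ρ) : ContDiff ℝ ∞ (tubeHat ε κ η ρ) := by
  have hp : ContDiff ℝ ∞ (RadialThickening.proj : 𝔼 4 → 𝔼 2) := RadialThickening.proj.contDiff
  have hn : ContDiff ℝ ∞ fun u : 𝔼 4 => nsq (RadialThickening.proj u) := contDiff_nsq.comp hp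
  have h0 : ContDiff ℝ ∞ fun u : 𝔼 4 => (RadialThickening.proj u) 0 := (d0 : 𝔼 2 →L[ℝ] ℝ).contDiff.comp hp
  unfold tubeHat ChartZone.gmod
  exact (contDiff_const.sub (contDiff_const.mul ((h0.pow 2).mul (hρ.comp hn)))).add
    ((contDiff_const.mul hn).mul RadialThickening.contDiff_bsq)

/-- `𝒯 ≤ 1 + (κ/η)|x⃗|²|y⃗|²` for `ε ≥ 0`. [folklore] -/
theorem tube_le {ε : ℝ} (hε : 0 ≤ ε) (κ η : ℝ) (u : 𝔼 4) :
    tube ε κ η u ≤ 1 + κ / η * nsq (RadialThickening.proj u) * RadialThickening.bsq u := by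
  rw [tube_apply, gcore_apply]
  have : 0 ≤ ε * ((RadialThickening.proj u) 0 ^ 2 / nsq (RadialThickening.proj u)) := by
    apply mul_nonneg hε
    apply div_nonneg (sq_nonneg _)
    rw [nsq_apply]; positivity
  linarith

end TubeModel

variable {X : Type u} [TopologicalSpace X] [T2Space X] [CompactSpace X] [ChartedSpace (𝔼 4) X]
  [IsManifold (𝓡 4) ∞ X]
  {f : X → ℝ} {ξ : Π x : X, TangentSpace (𝓡 4) x} {a η : ℝ} {ι : Type} [Fintype ι]

namespace HandleBoxes

variable (H : HandleBoxes f ξ a η ι)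

/-! ### Zone sets `{A_j < α}` -/

/-- The **zone** `{z ∈ source_j | A_j z < α}` (chart zone `α = a_R`). [cite: GayKirby2016, §4, Lemma 14] -/
def zone (α : ℝ) (j : ι) : Set X := {z | z ∈ (H.box j).chart.source ∧ H.A j z < α}

omit [T2Space X] [CompactSpace X] [IsManifold (𝓡 4) ∞ X] [Fintype ι] in
/-- The zones are open. [folklore] -/
theorem isOpen_zone (α : ℝ) (j : ι) : IsOpen (H.zone α j) :=
  (H.continuousOn_A j).isOpen_inter_preimage (H.box j).chart.open_source isOpen_Iio

omit [T2Space X] [CompactSpace X] [IsManifold (𝓡 4) ∞ X] [Fintype ι] in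
/-- The zones are pairwise disjoint. [folklore] -/
theorem zone_disjoint (α : ℝ) {i j : ι} (hij : i ≠ j) : Disjoint (H.zone α i) (H.zone α j) :=
  (H.disjoint hij).mono (fun _ hz => hz.1) (fun _ hz => hz.1)

omit [T2Space X] [CompactSpace X] [IsManifold (𝓡 4) ∞ X] [Fintype ι] in
/-- Band points of a zone `{A_j < α}`, `α ≤ η`, lie in the box, with `B_j < 2η`. [folklore] -/
theorem mem_box_of_mem_zone {α : ℝ} (hα : α ≤ η) {j : ι} {z : X} (hz : z ∈ H.zone α j)
    (hf₂ : f z < a + 2 * η) : z ∈ (H.box j).box ∧ H.B j z < 2 * η := by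
  have hη := H.eta_pos
  have hε := H.eta_lt j
  have hfz := H.apply_eq hz.1
  have hA : H.A j z < α := hz.2
  have hA0 := H.A_nonneg j z
  have hB : H.B j z < 2 * η := by linarith
  exact ⟨⟨hz.1, by unfold HandleBoxes.A at hA; linarith, by unfold HandleBoxes.B at hB; nlinarith⟩, hB⟩

omit [CompactSpace X] [IsManifold (𝓡 4) ∞ X] [Fintype ι] in
/-- A band point outside `source_j` has a neighbourhood missing the zone `{A_j < α}`, `α ≤ η`. [folklore] -/
theorem eventually_not_mem_zone_of_not_mem_source {α : ℝ} (hα : α ≤ η) (hf : Continuous f) {j : ι}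
    {z : X} (hz : z ∉ (H.box j).chart.source) (hf₂ : f z < a + 2 * η) :
    ∀ᶠ w in 𝓝 z, w ∉ H.zone α j := by
  set K : Set X := {q' | q' ∈ (H.box j).chart.source ∧ sqSumLT (H.box j).k ((H.box j).coord q') ≤ (H.box j).ε ^ 2 ∧
      sqSumGE (H.box j).k ((H.box j).coord q') ≤ 4 * (H.box j).ε ^ 2} with hK
  have hKc : IsClosed K := (H.box j).isClosed_closedBox
  have hzK : z ∉ K := fun h => hz h.1
  have hband : ∀ᶠ w in 𝓝 z, f w < a + 2 * η := hf.continuousAt.eventually (Iio_mem_nhds hf₂)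
  filter_upwards [hKc.isOpen_compl.mem_nhds hzK, hband] with w hwK hw hwS
  exact hwK ((H.box j).box_subset_closedBox (H.mem_box_of_mem_zone hα hwS hw).1)

/-! ### The smoothed tube function of a box -/

/-- `𝒯̂_j = tubeHat ∘ coord_j`. [cite: GayKirby2016, §4, Lemma 14] -/
def tubeHat (ε κ : ℝ) (ρ : ℝ → ℝ) (j : ι) (z : X) : ℝ := TubeModel.tubeHat ε κ η ρ ((H.box j).coord z)

omit [T2Space X] [CompactSpace X] [Fintype ι] in
/-- `𝒯̂_j` is smooth on `source_j`. [folklore] -/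
theorem contMDiffAt_tubeHat (ε κ : ℝ) {ρ : ℝ → ℝ} (hρ : ContDiff ℝ ∞ ρ) {j : ι} {z : X}
    (hz : z ∈ (H.box j).chart.source) : ContMDiffAt (𝓡 4) 𝓘(ℝ, ℝ) ∞ (H.tubeHat ε κ ρ j) z :=
  ((TubeModel.contDiff_tubeHat ε κ η hρ).contMDiff.contMDiffAt).comp z ((H.box j).contMDiffAt_coord hz)

omit [T2Space X] [CompactSpace X] [IsManifold (𝓡 4) ∞ X] [Fintype ι] in
/-- `A_j = |π (coord_j)|²` (index `2`). [folklore] -/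
theorem A_eq_nsq (j : ι) (z : X) : H.A j z = TubeModel.nsq (RadialThickening.proj ((H.box j).coord z)) := by
  rw [A_def, H.k_eq j, sqSumLT_two_eq_nsq]

omit [T2Space X] [CompactSpace X] [IsManifold (𝓡 4) ∞ X] [Fintype ι] in
/-- `B_j = bsq (coord_j)` (index `2`). [folklore] -/
theorem B_eq_bsq (j : ι) (z : X) : H.B j z = RadialThickening.bsq ((H.box j).coord z) := by
  rw [B_def, H.k_eq j, sqSumGE_two_eq_bsq]

omit [T2Space X] [CompactSpace X] [IsManifold (𝓡 4) ∞ X] [Fintype ι] in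
/-- `𝒯̂_j = 𝒯 ∘ coord_j` where `ρ(A_j) = 1/A_j`. [cite: GayKirby2016, §4, Lemma 14] -/
theorem tubeHat_eq_tube {ε κ : ℝ} {ρ : ℝ → ℝ} {j : ι} {z : X} (hρ : ρ (H.A j z) = (H.A j z)⁻¹) :
    H.tubeHat ε κ ρ j z = TubeModel.tube ε κ η ((H.box j).coord z) := by
  unfold tubeHat
  rw [A_eq_nsq] at hρ
  exact TubeModel.tubeHat_eq_tube hρ

omit [T2Space X] [CompactSpace X] [IsManifold (𝓡 4) ∞ X] [Fintype ι] in
/-- `𝒯 (coord_j z) ≤ 1 + (κ/η) P_j z` (`ε ≥ 0`). [folklore] -/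
theorem tube_coord_le {ε : ℝ} (hε : 0 ≤ ε) (κ : ℝ) (j : ι) (z : X) :
    TubeModel.tube ε κ η ((H.box j).coord z) ≤ 1 + κ / η * H.P j z := by
  have := TubeModel.tube_le hε κ η ((H.box j).coord z)
  rw [P_def, A_eq_nsq, B_eq_bsq]
  linarith

/-! ### The weight -/

/-- **The weight** `W`: `w(c₀ 𝒯̂_j)` on the chart zones `{A_j < a_R}`, `w(φ̄)` elsewhere.
[cite: GayKirby2016, §4, Lemma 14] -/
def weight (hξ : ContMDiff (𝓡 4) (𝓡 4).tangent ∞ fun x => (⟨x, ξ x⟩ : TangentBundle (𝓡 4) X))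
    (h : IsRegularLevel (𝓡 4) f a) (φ : RegularLevel h → ℝ) (w ρ : ℝ → ℝ) (c₀ ε κ aR : ℝ) (z : X) : ℝ :=
  w (flowLift hξ h φ z) +
    ∑ j, (H.zone aR j).indicator (fun z' => w (c₀ * H.tubeHat ε κ ρ j z') - w (flowLift hξ h φ z')) z

variable {hξ : ContMDiff (𝓡 4) (𝓡 4).tangent ∞ fun x => (⟨x, ξ x⟩ : TangentBundle (𝓡 4) X)}
  {h : IsRegularLevel (𝓡 4) f a} {φ : RegularLevel h → ℝ} {w ρ : ℝ → ℝ} {c₀ ε κ aR : ℝ}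

/-- **On the chart zone, `W = w(c₀ 𝒯̂_j)`.** [cite: GayKirby2016, §4, Lemma 14] -/
theorem weight_of_mem_zone {j : ι} {z : X} (hz : z ∈ H.zone aR j) :
    H.weight hξ h φ w ρ c₀ ε κ aR z = w (c₀ * H.tubeHat ε κ ρ j z) := by
  unfold weight
  rw [Finset.sum_eq_single j]
  · rw [indicator_of_mem hz]; ring
  · intro i _ hij
    rw [indicator_of_notMem]
    exact fun hi => (H.zone_disjoint aR hij).le_bot ⟨hi, hz⟩
  · intro hj; exact absurd (Finset.mem_univ j) hj

/-- **Off the chart zones, `W = w(φ̄)`.** [cite: GayKirby2016, §4, Lemma 14] -/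
theorem weight_of_forall_not_mem {z : X} (hz : ∀ j, z ∉ H.zone aR j) :
    H.weight hξ h φ w ρ c₀ ε κ aR z = w (flowLift hξ h φ z) := by
  unfold weight
  rw [Finset.sum_eq_zero fun j _ => indicator_of_notMem (hz j) _, add_zero]

omit [Fintype ι] in
/-- **The lifted Heegaard function on the band part of a chart domain with `A_j < η`**: such a
point lies above the level, hits it, and `φ̄ z = c₀ 𝒯(coord_j z)` — given the explicit form
`φ = c₀ 𝒯 ∘ coord_j` on the part of the level in `source_j` where `𝒯 < 1 + 2δ'`, and
`(κ/η) · 2η² ≤ 2δ'`… precisely `κ/η · P_j z < 2δ'`. [cite: GayKirby2016, §4, Lemma 14]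
[cite: MilnorHCobordism1965, proof of Thm. 3.12; Thm. 4.1] -/
theorem flowLift_eq_of_A_lt (hgl : IsGradientLike (𝓡 4) f ξ) (hfM : IsMorse (𝓡 4) f)
    (hε : 0 ≤ ε) {δ' : ℝ}
    (hφ : ∀ j (y : RegularLevel h), y.1 ∈ (H.box j).chart.source →
      TubeModel.tube ε κ η ((H.box j).coord y.1) < 1 + 2 * δ' →
      φ y = c₀ * TubeModel.tube ε κ η ((H.box j).coord y.1))
    {j : ι} {z : X} (hzsrc : z ∈ (H.box j).chart.source) (hA : H.A j z < η) (hApos : 0 < H.A j z)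
    (hf₂ : f z < a + 2 * η) (hP : κ / η * H.P j z < 2 * δ') :
    Hits (flowθ hξ) f a z ∧ flowLift hξ h φ z = c₀ * TubeModel.tube ε κ η ((H.box j).coord z) := by
  have hη := H.eta_pos
  have hε' := H.eta_lt j
  have hfz := H.apply_eq hzsrc
  have hB0 := H.B_nonneg j z
  have hB : H.B j z ≤ 2 * η := by linarith
  have hfz' : f (H.cpt j) - η ≤ f z := by rw [H.level_eq j]; linarith
  have hsmall : η + 2 * η < (H.box j).ε ^ 2 := by linarith
  obtain ⟨t, ht, hhits, hproj, hseg, hPt, htube, -⟩ :=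
    (H.box j).exists_levelProj_eq_flow (hξ := hξ) (H.k_eq j) hgl hfM hη hsmall (H.forall_not_isMCriticalPt j)
      hzsrc hApos hfz' hB
  rw [H.level_eq j] at hhits hproj
  refine ⟨hhits, ?_⟩
  rw [flowLift_of_hits φ hhits]
  set y : RegularLevel h := ⟨levelProj hξ f a z, apply_levelProj hξ hhits⟩ with hy
  have hy1 : y.1 = flow hξ z t := hproj
  have hsrc : y.1 ∈ (H.box j).chart.source := by rw [hy1]; exact (hseg t ⟨le_rfl, ht⟩).1
  have htube' : TubeModel.tube ε κ η ((H.box j).coord y.1) = TubeModel.tube ε κ η ((H.box j).coord z) := by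
    rw [hy1]; exact htube ε κ η
  have hlt : TubeModel.tube ε κ η ((H.box j).coord y.1) < 1 + 2 * δ' := by
    rw [htube']
    have := H.tube_coord_le hε κ j z
    linarith
  rw [hφ j y hsrc hlt, htube']

omit [Fintype ι] in
/-- **The two recipes for the weight agree on the shell** `{0 < A_j < η} ∩ band ∩ {ρ(A_j) = 1/A_j}`
(and `(κ/η) P_j < 2δ'`): there `w(φ̄) = w(c₀ 𝒯̂_j)`. [cite: GayKirby2016, §4, Lemma 14] -/
theorem w_flowLift_eq_of_mem_shell (hgl : IsGradientLike (𝓡 4) f ξ) (hfM : IsMorse (𝓡 4) f)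
    (hε : 0 ≤ ε) {δ' : ℝ}
    (hφ : ∀ j (y : RegularLevel h), y.1 ∈ (H.box j).chart.source →
      TubeModel.tube ε κ η ((H.box j).coord y.1) < 1 + 2 * δ' →
      φ y = c₀ * TubeModel.tube ε κ η ((H.box j).coord y.1))
    {j : ι} {z : X} (hzsrc : z ∈ (H.box j).chart.source) (hA : H.A j z < η) (hApos : 0 < H.A j z)
    (hf₂ : f z < a + 2 * η) (hP : κ / η * H.P j z < 2 * δ') (hρ : ρ (H.A j z) = (H.A j z)⁻¹) :
    w (flowLift hξ h φ z) = w (c₀ * H.tubeHat ε κ ρ j z) := by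
  rw [(H.flowLift_eq_of_A_lt hgl hfM hε hφ hzsrc hA hApos hf₂ hP).2, H.tubeHat_eq_tube hρ]

/-- **The weight is smooth on the band** `f < a + 2η` (points with `f ≤ a - η` do not occur
near the chart zones, but the statement is local: hypotheses at `z`).  Hypotheses: `w`, `ρ`
smooth; `0 < a_R`, `2a_R ≤ η`; `ρ(A) = 1/A` for `A ∈ [a_R/2, 2a_R]`; `(κ/η)(2a_R)(2η) < 2δ'`; the
explicit form of `φ` near the tubes; and `z` is a band point which hits the level unless it
lies in a chart zone. [cite: GayKirby2016, §4, Lemma 14] -/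
theorem contMDiffAt_weight (hgl : IsGradientLike (𝓡 4) f ξ) (hfM : IsMorse (𝓡 4) f)
    (hφs : ContMDiff (𝓡 3) 𝓘(ℝ, ℝ) ∞ φ) (hw : ContDiff ℝ ∞ w) (hρs : ContDiff ℝ ∞ ρ)
    (hε : 0 ≤ ε) (hκ : 0 ≤ κ) {δ' : ℝ} (haR : 0 < aR) (haR2 : 2 * aR ≤ η)
    (hρ : ∀ A, aR / 2 ≤ A → A ≤ 2 * aR → ρ A = A⁻¹)
    (hκδ : κ / η * (2 * aR) * (2 * η) < 2 * δ')
    (hφ : ∀ j (y : RegularLevel h), y.1 ∈ (H.box j).chart.source →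
      TubeModel.tube ε κ η ((H.box j).coord y.1) < 1 + 2 * δ' →
      φ y = c₀ * TubeModel.tube ε κ η ((H.box j).coord y.1))
    {z : X} (hf₁ : a - η < f z) (hf₂ : f z < a + 2 * η) :
    ContMDiffAt (𝓡 4) 𝓘(ℝ, ℝ) ∞ (H.weight hξ h φ w ρ c₀ ε κ aR) z := by
  have hη := H.eta_pos
  have hcontf : Continuous f := hfM.contMDiff.continuous
  have hband : ∀ᶠ w' in 𝓝 z, a - η < f w' ∧ f w' < a + 2 * η :=
    (hcontf.continuousAt.eventually (Ioo_mem_nhds hf₁ hf₂)).mono fun w hw => hw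
  -- smoothness of the two recipes
  have hrecipe₁ : ∀ {j : ι}, z ∈ (H.box j).chart.source →
      ContMDiffAt (𝓡 4) 𝓘(ℝ, ℝ) ∞ (fun z' => w (c₀ * H.tubeHat ε κ ρ j z')) z := fun hz =>
    (hw.contMDiff.contMDiffAt).comp z (contMDiffAt_const.mul (H.contMDiffAt_tubeHat ε κ hρs hz))
  have hrecipe₂ : Hits (flowθ hξ) f a z → ContMDiffAt (𝓡 4) 𝓘(ℝ, ℝ) ∞ (fun z' => w (flowLift hξ h φ z')) z :=
    fun hh => (hw.contMDiff.contMDiffAt).comp z (contMDiffAt_flowLift hgl hfM hφs hh)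
  by_cases h1 : ∃ j, z ∈ H.zone aR j
  · -- inside a chart zone
    obtain ⟨j, hz⟩ := h1
    have hev : H.weight hξ h φ w ρ c₀ ε κ aR =ᶠ[𝓝 z] fun z' => w (c₀ * H.tubeHat ε κ ρ j z') := by
      filter_upwards [(H.isOpen_zone aR j).mem_nhds hz] with w' hw'
      exact H.weight_of_mem_zone hw'
    exact (hrecipe₁ hz.1).congr_of_eventuallyEq hev
  · push Not at h1
    -- `z` hits the level (a non-hitting band point lies on a disc, inside a chart zone)
    have hhit : Hits (flowθ hξ) f a z := by
      rcases H.hits_or_exists_A_eq_zero (hξ := hξ) hgl hfM hf₁ hf₂ with hh | ⟨j, hbox, hA⟩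
      · exact hh
      · exact absurd ⟨hbox.1, by rw [hA]; exact haR⟩ (h1 j)
    by_cases h2 : ∃ j, z ∈ (H.box j).chart.source ∧ H.A j z < 2 * aR
    · -- on the shell around the interface `A_j = a_R`: both recipes agree nearby
      obtain ⟨j, hzsrc, hzA⟩ := h2
      have hzA' : aR ≤ H.A j z := by
        by_contra hlt; push Not at hlt; exact h1 j ⟨hzsrc, hlt⟩
      have hcA : ContinuousAt (H.A j) z :=
        (H.continuousOn_A j).continuousAt ((H.box j).chart.open_source.mem_nhds hzsrc)
      have hev : H.weight hξ h φ w ρ c₀ ε κ aR =ᶠ[𝓝 z] fun z' => w (c₀ * H.tubeHat ε κ ρ j z') := by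
        filter_upwards [(H.box j).chart.open_source.mem_nhds hzsrc,
          hcA.eventually (Ioo_mem_nhds (show aR / 2 < H.A j z by linarith) hzA), hband] with w' hw' hA' hf'
        by_cases hzone : w' ∈ H.zone aR j
        · exact H.weight_of_mem_zone hzone
        · have hall : ∀ i, w' ∉ H.zone aR i := by
            intro i hi
            by_cases hij : i = j
            · subst hij; exact hzone hi
            · exact (H.disjoint hij).le_bot ⟨hi.1, hw'⟩
          rw [H.weight_of_forall_not_mem hall]
          have hApos : 0 < H.A j w' := by linarith [hA'.1]
          have hAη : H.A j w' < η := by linarith [hA'.2]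
          have hP : κ / η * H.P j w' < 2 * δ' := by
            have hB : H.B j w' < 2 * η := by
              have := H.apply_eq hw'; linarith [hf'.2, H.A_nonneg j w']
            have hPle : H.P j w' ≤ 2 * aR * (2 * η) := by
              rw [P_def]
              exact mul_le_mul hA'.2.le hB.le (H.B_nonneg j w') (by linarith)
            have hκη : 0 ≤ κ / η := div_nonneg hκ hη.le
            have h1 : κ / η * H.P j w' ≤ κ / η * (2 * aR * (2 * η)) := mul_le_mul_of_nonneg_left hPle hκη
            have h2 : κ / η * (2 * aR * (2 * η)) = κ / η * (2 * aR) * (2 * η) := by ring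
            linarith
          exact H.w_flowLift_eq_of_mem_shell hgl hfM hε hφ hw' hAη hApos hf'.2 hP (hρ _ hA'.1.le hA'.2.le)
      exact (hrecipe₁ hzsrc).congr_of_eventuallyEq hev
    · -- away from the chart zones: `W = w(φ̄)` nearby
      push Not at h2
      have hev1 : ∀ i, ∀ᶠ w' in 𝓝 z, w' ∉ H.zone aR i := by
        intro i
        by_cases hi : z ∈ (H.box i).chart.source
        · have hcA : ContinuousAt (H.A i) z :=
            (H.continuousOn_A i).continuousAt ((H.box i).chart.open_source.mem_nhds hi)
          have hge : aR < H.A i z := by linarith [h2 i hi]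
          filter_upwards [hcA.eventually (Ioi_mem_nhds hge)] with w' hw' hwS
          exact absurd hwS.2 (not_lt.2 (le_of_lt hw'))
        · exact H.eventually_not_mem_zone_of_not_mem_source (by linarith) hcontf hi hf₂
      have hev : H.weight hξ h φ w ρ c₀ ε κ aR =ᶠ[𝓝 z] fun z' => w (flowLift hξ h φ z') := by
        filter_upwards [Filter.eventually_all.2 hev1] with w' hw'
        exact H.weight_of_forall_not_mem hw'
      exact (hrecipe₂ hhit).congr_of_eventuallyEq hev

/-! ### The radial correction -/

/-- **The radial correction** `R`: `R₀(A_j)` on `source_j`, `1` elsewhere. [cite: GayKirby2016, §4, Lemma 14] -/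
def radial (R₀ : ℝ → ℝ) (z : X) : ℝ :=
  1 + ∑ j, ((H.box j).chart.source).indicator (fun z' => R₀ (H.A j z') - 1) z

omit [T2Space X] [CompactSpace X] [IsManifold (𝓡 4) ∞ X] in
/-- **On `source_j`, `R = R₀(A_j)`.** [folklore] -/
theorem radial_of_mem_source {R₀ : ℝ → ℝ} {j : ι} {z : X} (hz : z ∈ (H.box j).chart.source) :
    H.radial R₀ z = R₀ (H.A j z) := by
  unfold radial
  rw [Finset.sum_eq_single j]
  · rw [indicator_of_mem hz]; ring
  · intro i _ hij
    rw [indicator_of_notMem]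
    exact fun hi => (H.disjoint hij).le_bot ⟨hi, hz⟩
  · intro hj; exact absurd (Finset.mem_univ j) hj

omit [T2Space X] [CompactSpace X] [IsManifold (𝓡 4) ∞ X] in
/-- **Off the chart domains, `R = 1`.** [folklore] -/
theorem radial_of_forall_not_mem {R₀ : ℝ → ℝ} {z : X} (hz : ∀ j, z ∉ (H.box j).chart.source) :
    H.radial R₀ z = 1 := by
  unfold radial
  rw [Finset.sum_eq_zero fun j _ => indicator_of_notMem (hz j) _, add_zero]

omit [T2Space X] [CompactSpace X] [IsManifold (𝓡 4) ∞ X] in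
/-- `R = 1` at points of `source_j` with `A_j ≥ a_R'` when `R₀ = 1` on `[a_R', ∞)`. [folklore] -/
theorem radial_eq_one_of_le {R₀ : ℝ → ℝ} {aR' : ℝ} (hR₀ : ∀ A, aR' ≤ A → R₀ A = 1) {z : X}
    (hz : ∀ j, z ∈ (H.box j).chart.source → aR' ≤ H.A j z) : H.radial R₀ z = 1 := by
  by_cases h : ∃ j, z ∈ (H.box j).chart.source
  · obtain ⟨j, hj⟩ := h
    rw [H.radial_of_mem_source hj, hR₀ _ (hz j hj)]
  · push Not at h
    exact H.radial_of_forall_not_mem h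

omit [CompactSpace X] in
/-- **The radial correction is smooth on the band** `f < a + 2η`, when `R₀` is smooth and
`R₀ = 1` on `[a_R', ∞)` with `0 < a_R' ≤ η`. [cite: GayKirby2016, §4, Lemma 14] -/
theorem contMDiffAt_radial (hfM : IsMorse (𝓡 4) f) {R₀ : ℝ → ℝ} (hR₀s : ContDiff ℝ ∞ R₀) {aR' : ℝ}
    (haR' : aR' ≤ η) (hR₀ : ∀ A, aR' ≤ A → R₀ A = 1) {z : X} (hf₂ : f z < a + 2 * η) :
    ContMDiffAt (𝓡 4) 𝓘(ℝ, ℝ) ∞ (H.radial R₀) z := by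
  have hcontf : Continuous f := hfM.contMDiff.continuous
  by_cases h1 : ∃ j, z ∈ (H.box j).chart.source
  · obtain ⟨j, hz⟩ := h1
    have hev : H.radial R₀ =ᶠ[𝓝 z] fun z' => R₀ (H.A j z') := by
      filter_upwards [(H.box j).chart.open_source.mem_nhds hz] with w hw
      exact H.radial_of_mem_source hw
    refine ContMDiffAt.congr_of_eventuallyEq ?_ hev
    exact (hR₀s.contMDiff.contMDiffAt).comp z (H.contMDiffAt_A hz)
  · push Not at h1
    have hev1 : ∀ i, ∀ᶠ w in 𝓝 z, w ∉ H.zone aR' i := fun i =>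
      H.eventually_not_mem_zone_of_not_mem_source haR' hcontf (h1 i) hf₂
    have hev : H.radial R₀ =ᶠ[𝓝 z] fun _ => 1 := by
      filter_upwards [Filter.eventually_all.2 hev1] with w hw
      refine H.radial_eq_one_of_le hR₀ fun j hj => ?_
      by_contra hlt
      push Not at hlt
      exact hw j ⟨hj, hlt⟩
    exact contMDiffAt_const.congr_of_eventuallyEq hev

end HandleBoxes

end Literature.Topology.FourManifolds

end
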